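import Summits.QuantumFields.BalabanUV.T4Continuum.Support.NE7NestedCovariantExtension
import Summits.QuantumFields.BalabanUV.T4Continuum.Support.NE7GaugeFunctionSupLetter
import HarnessLib

/-!
# NE7SliceGaugeFunctionSized — THE SPIKE-FREE LINEAR SLICE SPLIT WITH ITS SIZE LETTER: `T = Ỹ + gaugeDir W ζ`, `Ỹ ∈ 𝒯_E(W)`, the nested mean of the TOTAL gauge
# function is EXACTLY `−(framePotW T − h)`, hence `sup‖ζ‖ ≤ (m + 2d(M−1)(S_T + S_Y))∕(1−θ)` (memo ROAD-G100 §2.4: (GF) completed — the corollary of p762499 §3 and p762572 §3)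

Cell `pub-balaban`, rung (B)+1 sub-cell t4, lineage `b2b-balaban-t4-ne7-p1`, generation 100 (CRUX PROVER NE7 #1 = OWNER of BINDER row NE7).  Memo `t4/b2b-balaban-t4-ne7-p1-g100/ROAD-G100.md`
§2.4 (GF): the supplier (S1) of the END's `hdecomp♭` iterates linear slice corrections; at each step the direction `T` (skew, periodic, `dirIter T = gaugeDir_V h` a coarse pure gauge) is split as
`T = Ỹ + gaugeDir W ζ` with `Ỹ ∈ 𝒯_E(W) = energyBlockLandauW L N (k+1) W` by `NE7NestedCovariantExtension.exists_fullGauge_split_general` (`ζ = −(nestedExt(framePotW T − h) + η)`, `η ∈ Ξ_Q(W)`),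
and the engine needs the SIZE of `ζ`.  THIS FILE is the junction of that split with the letter `NE7GaugeFunctionSupLetter.sup_gauge_of_split`: the one missing line is the EXACT nested mean of
the total gauge function, `bmeanIterW L (k+1) W ζ = −(framePotW T − h)` (`bmeanIterW_nestedExt` is exact and `bmeanIterW η = 0`), so the letter applies with `m := sup‖framePotW T − h‖`.
WHAT ([folklore]; 0 def, 0 sorry).
§1 `bmeanIterW_neg_add` (linearity bookkeeping).
§2 **`exists_fullGauge_split_sized`**: class hypotheses (`2 ≤ L`, `W` unitary `(tower L N (j+1))`-periodic, `0 ≤ x`, `LevelSmall`, `SmallField W x`), `T` skew periodic with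
   `dirIter L (j+1) W T = gaugeDir (cavgIter L (j+1) W) h` (`h` skew `N`-periodic) ⟹ `∃ ζ XE`: `ζ` skew periodic, `XE ∈ energyBlockLandauW L N (j+1) W`, `T = XE + gaugeDir W ζ`,
   **`∀ z, bmeanIterW L (j+1) W ζ z = −(framePotW L (j+1) W T z − h z)`**, and THE SIZE LETTER: for all `S_T, S_Y, m` bounding `‖T‖`, `‖XE‖`, `‖framePotW T − h‖` and `θ < 1`
   (`θ = 4d²(M−1)²x + 16d·loopRad d L (prop1Radius^[j] x) + 4d(d−1)(M−1)²x`), `∀ y, ‖ζ y‖ ≤ (m + 2d(M−1)(S_T + S_Y))∕(1−θ)`.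
   (The bound on `‖XE‖` is an INPUT: in (S1) it is supplied by the curved sup letter (L) of `𝒯_E(W)` from `curl_W XE`; memo §4.)
HONEST FRAMING (page 1): linear kinematics at ONE background plus the landed sup letter; nothing of Bałaban's asserted; NOT (L), NOT (S1), NOT NE7; spine 0∕9; finite T⁴ rung (B)+1 — NOT infinite
volume, NOT mass gap, NOT BetaPertH, NOT Clay.  Continuum YM on T⁴ ⇐ BetaPertH ∧ nine spine estimates (0/9 proved); BetaPertH ⇐ (D1) ∧ (D4) ∧ CAP+tail; G-an2-4 gates asym, D1 and NE2/3/4.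
-/

set_option autoImplicit false

open scoped BigOperators Matrix.Norms.L2Operator
open Finset

namespace Summit.QuantumFields.BalabanUV.T4Continuum.NE7SliceGaugeFunctionSized

open Literature.MathematicalPhysics.QuantumFieldTheory.Balaban1983to89
open B7Prop1Explicit B7Prop2Explicit
open T4AveragingDeficitWall (IsUnitaryCfg IsSkewDir SmallField Ad)
open T4AveragingDeficitWallBoundary (IsPeriodicCfg periodBox)
open AveragingDeficitPeriodicCounting (IsPeriodicDir)
open AveragingDeficitTwoLevelPrep (prop1Radius)
open AveragingDeficitMultiLevelPrep (cavgIter LevelSmall tower)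
open BlockAveragePushDirGauge (gaugeDir)
open NE3TangentCovariantTower (framePotW dirIter)
open NE3CovariantBlockMean (bmeanIterW)
open NE3FrameFreeSliceW (bmeanIterW_add bmeanIterW_smul)
open NE7MeanZeroGaugeSliceW (energyBlockLandauW meanZeroGaugeSpaceW mem_meanZeroGaugeSpaceW_iff)
open NE7NestedCovariantExtension (nestedExt bmeanIterW_nestedExt exists_fullGauge_split_general)
open NE7GaugeFunctionSupLetter (sup_gauge_of_split)
open SpreadLift (loopRad)

noncomputable section

variable {d : ℕ} {n : Type*} [Fintype n] [DecidableEq n]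

/-! ## §1 Linearity bookkeeping -/

/-- `bmeanIterW` of `−(A + B)` is `−(bmeanIterW A + bmeanIterW B)`, pointwise. [folklore] -/
theorem bmeanIterW_neg_add (L j : ℕ) (W : Site d → Fin d → (Matrix n n ℂ)ˣ) (A B : Site d → Matrix n n ℂ) (z : Site d) :
    bmeanIterW L j W (fun y => -(A y + B y)) z = -(bmeanIterW L j W A z + bmeanIterW L j W B z) := by
  have e : (fun y => -(A y + B y)) = (-1 : ℝ) • (A + B) := by
    funext y; simp only [Pi.smul_apply, Pi.add_apply, neg_one_smul]
  rw [e, bmeanIterW_smul, bmeanIterW_add]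
  simp only [Pi.smul_apply, Pi.add_apply, neg_one_smul]

/-! ## §2 The split with the exact nested mean and the size letter -/

/-- **THE SPIKE-FREE SLICE SPLIT, SIZED** (multi-level small-field class at level `j+1`; `M = L^{j+1}`): for skew `(tower L N (j+1))`-periodic `T` with
`dirIter L (j+1) W T = gaugeDir (cavgIter L (j+1) W) h` (`h` skew, `N`-periodic) there are `ζ` (skew, periodic) and `XE ∈ energyBlockLandauW L N (j+1) W` with `T = XE + gaugeDir W ζ`,
the nested mean of `ζ` EXACTLY `−(framePotW T − h)`, and — for any bounds `‖T‖ ≤ S_T`, `‖XE‖ ≤ S_Y`, `‖framePotW T − h‖ ≤ m` and `θ < 1` —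
`‖ζ y‖ ≤ (m + 2d(M−1)(S_T + S_Y))∕(1 − θ)` at every site. [folklore] -/
theorem exists_fullGauge_split_sized [Nonempty n] {L N : ℕ} [NeZero N] (hL : 2 ≤ L) (j : ℕ)
    {W : Site d → Fin d → (Matrix n n ℂ)ˣ} {x : ℝ} (hWu : IsUnitaryCfg W) (hWP : IsPeriodicCfg W ((tower L N (j + 1) : ℕ) : ℤ))
    (hx : 0 ≤ x) (hs : LevelSmall d L j x) (hWx : SmallField W x)
    {T : Site d → Fin d → Matrix n n ℂ} (hT : IsSkewDir T) (hTP : IsPeriodicDir T ((tower L N (j + 1) : ℕ) : ℤ))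
    {h : Site d → Matrix n n ℂ} (hh : ∀ z, h z ∈ skewAdjoint (Matrix n n ℂ)) (hhP : ∀ (z : Site d) (i : Fin d), h (z + (N : ℤ) • e i) = h z)
    (hdir : dirIter L (j + 1) W T = gaugeDir (cavgIter L (j + 1) W) h) :
    ∃ (ζ : Site d → Matrix n n ℂ) (XE : Site d → Fin d → Matrix n n ℂ),
      (∀ y, ζ y ∈ skewAdjoint (Matrix n n ℂ)) ∧ (∀ (y : Site d) (i : Fin d), ζ (y + ((tower L N (j + 1) : ℕ) : ℤ) • e i) = ζ y) ∧
      XE ∈ energyBlockLandauW (d := d) (n := n) L N (j + 1) W ∧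
      (∀ y μ, T y μ = XE y μ + gaugeDir W ζ y μ) ∧
      (∀ z, bmeanIterW L (j + 1) W ζ z = -(framePotW L (j + 1) W T z - h z)) ∧
      ∀ (S_T S_Y m : ℝ), (∀ y μ, ‖T y μ‖ ≤ S_T) → (∀ y μ, ‖XE y μ‖ ≤ S_Y) → (∀ z, ‖framePotW L (j + 1) W T z - h z‖ ≤ m) →
        4 * (d : ℝ) ^ 2 * ((L : ℝ) ^ (j + 1) - 1) ^ 2 * x + 16 * d * loopRad d L ((prop1Radius d L)^[j] x)
            + 4 * d * ((d : ℝ) - 1) * ((L : ℝ) ^ (j + 1) - 1) ^ 2 * x < 1 →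
        ∀ y, ‖ζ y‖ ≤ (m + 2 * d * ((L : ℝ) ^ (j + 1) - 1) * (S_T + S_Y))
          / (1 - (4 * (d : ℝ) ^ 2 * ((L : ℝ) ^ (j + 1) - 1) ^ 2 * x + 16 * d * loopRad d L ((prop1Radius d L)^[j] x)
              + 4 * d * ((d : ℝ) - 1) * ((L : ℝ) ^ (j + 1) - 1) ^ 2 * x)) := by
  have hL1 : 1 ≤ L := by omega
  obtain ⟨ζ, XE, hζs, hζP, hXE, ⟨η, hη, hζeq⟩, hsplit⟩ := exists_fullGauge_split_general hL1 j hWu hWP hx hs hWx hT hTP hh hhP hdir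
  obtain ⟨-, hηm⟩ := mem_meanZeroGaugeSpaceW_iff.mp hη
  -- the exact nested mean of the total gauge function
  have hmean : ∀ z, bmeanIterW L (j + 1) W ζ z = -(framePotW L (j + 1) W T z - h z) := by
    intro z
    have eζ : ζ = fun y => -(nestedExt L (j + 1) W (fun z => framePotW L (j + 1) W T z - h z) y + η y) := funext hζeq
    rw [eζ, bmeanIterW_neg_add, bmeanIterW_nestedExt hL1, hηm, Pi.zero_apply, add_zero]
  have hP1 : 1 ≤ tower L N (j + 1) := by
    haveI : NeZero L := ⟨by omega⟩
    exact Nat.one_le_iff_ne_zero.mpr (NeZero.ne _)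
  refine ⟨ζ, XE, hζs, hζP, hXE, hsplit, hmean, fun S_T S_Y m hTb hYb hmb hθ y => ?_⟩
  have hm' : ∀ z, ‖bmeanIterW L (j + 1) W ζ z‖ ≤ m := fun z => by rw [hmean z, norm_neg]; exact hmb z
  exact sup_gauge_of_split hL j hWu hx hs hWx hsplit hTb hYb hm' hP1 hζP hθ y

end

end Summit.QuantumFields.BalabanUV.T4Continuum.NE7SliceGaugeFunctionSized
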